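import Mathlib
import Summits.CriticalPhenomena.SAWScalingLimit.Theses.SAWDevelopingMap

/-!
# Sketch — crux-ideate stmt-CriticalPhenomena-8296 (NoFoldBound), ideator 3, round 1

First-lemma signatures of the three idea cards (they need not be proved here; they must elaborate).
-/

noncomputable section

namespace Summit.CriticalPhenomena.SAWScalingLimit.Cruxes.NoFoldBound.Sketch

open Literature.Probability.RandomPlanarGeometry.SAW Literature.Probability.LatticeModels

/-! ## Card A — winding-law Fourier ratio -/

/-- A1 (analytic kernel of card A): a polynomial with nonnegative coefficients all of whose roots
are real (hence `≤ 0`) — the generating polynomial of a finite Pólya-frequency sequence — has a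
Fourier modulus `θ ↦ |p(e^{iθ})|` that is antitone on `[0, π]`
(each factor `|e^{iθ} + α|² = 1 + α² + 2α cos θ`, `α ≥ 0`, is antitone). -/
theorem A1_fourierModulus_antitone (p : Polynomial ℝ) (hcoef : ∀ n, 0 ≤ p.coeff n)
    (hsplit : p.Splits) :
    AntitoneOn (fun θ : ℝ => ‖Polynomial.aeval (Complex.exp (θ * Complex.I)) p‖)
      (Set.Icc 0 Real.pi) := by
  sorry

/-- A2 (the abstract no-fold criterion of card A): if a finitely supported nonnegative class law
`w` on `ℤ` has `|ŵ(195°)| ≤ |ŵ(75°)|` (equivalently `|ŵ(165°)| ≤ |ŵ(75°)|`), then with CONSTANT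
dressings `a > 0`, `0 ≤ b ≤ k a` the Beltrami-type quotient is at most `k`. (The card's full
criterion lets `a`, `b` vary in the intervals `[α_T - √3 x_c Z, α_T]`, `[β_T, β_T + √3 x_c Z]`.) -/
theorem A2_noFold_of_fourier (s : Finset ℤ) (w : ℤ → ℝ) (a b k : ℝ) (hw : ∀ n ∈ s, 0 ≤ w n)
    (ha : 0 < a) (hb : 0 ≤ b) (hk : b ≤ k * a)
    (hF : ‖∑ n ∈ s, (w n : ℂ) * Complex.exp (-(195 * Real.pi / 180 * n : ℝ) * Complex.I)‖ ≤
          ‖∑ n ∈ s, (w n : ℂ) * Complex.exp (-(75 * Real.pi / 180 * n : ℝ) * Complex.I)‖) :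
    ‖∑ n ∈ s, (b * w n : ℂ) * Complex.exp (-(195 * Real.pi / 180 * n : ℝ) * Complex.I)‖ ≤
      k * ‖∑ n ∈ s, (a * w n : ℂ) * Complex.exp (-(75 * Real.pi / 180 * n : ℝ) * Complex.I)‖ := by
  sorry

/-! ## Card B — contact-layer cone certificate -/

/-- B1 (soundness of a phase-sector certificate): if every channel vector satisfies
`‖B c‖ ≤ k · Re(conj d · M c)` for one unit direction `d`, then every NONNEGATIVE mixture of the
channels satisfies `‖Σ λ B‖ ≤ k ‖Σ λ M‖` — no fold for any far field. -/
theorem B1_dualWitness {ι : Type*} (s : Finset ι) (M B : ι → ℂ) (lam : ι → ℝ) (d : ℂ) (k : ℝ)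
    (hd : ‖d‖ = 1) (hk : 0 ≤ k) (hlam : ∀ c ∈ s, 0 ≤ lam c)
    (h : ∀ c ∈ s, ‖B c‖ ≤ k * ((starRingEnd ℂ) d * M c).re) :
    ‖∑ c ∈ s, (lam c : ℂ) * B c‖ ≤ k * ‖∑ c ∈ s, (lam c : ℂ) * M c‖ := by
  sorry

/-- B2 (the `r = 1` contact layer, provable now, sharp): at every NON-SOURCE vertex `v` of a simply
connected domain having a neighbour outside the domain, the Beltrami quotient of the critical
parafermionic observable is at most `β_T/α_T = (1 + 2x_c cos(11π/24))/(1 + 2x_c cos(5π/24))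
= 0.61402…` (first arrivals fall in at most two ADJACENT winding classes because `Λ \ {v}` is simply
connected, and their loop dressing vanishes because one of the two non-arrival ports is walled). -/
theorem B2_noFold_vertexBoundary :
    ∀ (Λ : Finset HexVertex), hexDomainSimplyConnected Λ → ∀ a ∈ hexDomainBoundary Λ, ∀ v ∈ Λ,
      v ∉ a → (∃ u : HexVertex, hexGraph.Adj v u ∧ u ∉ Λ) →
      ∀ w₀ w₁ w₂ : HexVertex, hexGraph.Adj v w₀ → hexGraph.Adj v w₁ → hexGraph.Adj v w₂ →
      w₀ ≠ w₁ → w₁ ≠ w₂ → w₀ ≠ w₂ →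
      let F : Sym2 HexVertex → ℂ := hexParafermionicObservable Λ a hexCriticalFugacity (5 / 8)
      let ω : ℂ := Complex.exp (2 * Real.pi * Complex.I / 3)
      ‖F s(v, w₀) + ω * F s(v, w₁) + ω ^ 2 * F s(v, w₂)‖ ≤
        ((1 + 2 * hexCriticalFugacity * Real.cos (11 * Real.pi / 24)) /
          (1 + 2 * hexCriticalFugacity * Real.cos (5 * Real.pi / 24))) *
        ‖F s(v, w₀) + F s(v, w₁) + F s(v, w₂)‖ := by
  sorry

/-! ## Card C — hexagon hull condition + Tutte/GGT embedding engine -/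

/-- C0: the HULL CONDITION of the developing map at the full hexagon around the site `x` of `𝕋`:
the six increments of the potential across the hexagon's edges — the observable on the six edges,
each rotated by its edge direction seen from the centre `triEmbed x`, i.e.
`(hexMidpoint e - triEmbed x) * I * F e` up to a common real factor — are not contained in a
closed half-plane through `0`: for every unit direction some increment has positive and some has
negative projection. (`H(y) - H(x) ∥ (tangent at the edge) · F(edge)`; the tangent at the edge `e`
of the hexagon centred at `triEmbed x` is `I · (hexMidpoint e - triEmbed x)` normalised.) -/
def HexHullCondition (Λ : Finset HexVertex) (a : Sym2 HexVertex) : Prop :=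
  ∀ x : Site 2, (∀ f : HexVertex, x ∈ hexFaceVertices f → f ∈ Λ) →
    ∀ d : ℂ, ‖d‖ = 1 →
      (∃ f g : HexVertex, x ∈ hexFaceVertices f ∧ x ∈ hexFaceVertices g ∧ hexGraph.Adj f g ∧
        0 < ((starRingEnd ℂ) d * ((hexMidpoint s(f, g) - triEmbed x) * Complex.I *
          hexParafermionicObservable Λ a hexCriticalFugacity (5 / 8) s(f, g))).re) ∧
      (∃ f g : HexVertex, x ∈ hexFaceVertices f ∧ x ∈ hexFaceVertices g ∧ hexGraph.Adj f g ∧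
        ((starRingEnd ℂ) d * ((hexMidpoint s(f, g) - triEmbed x) * Complex.I *
          hexParafermionicObservable Λ a hexCriticalFugacity (5 / 8) s(f, g))).re < 0)

/-- C1 (first lemma of card C, the discrete Radó–Kneser–Choquet / Tutte–Floater–GGT step, stated for
CONVEX image boundary = domains whose unwrapped outward normal is monotone; here in the weakest
useful form): hull condition at every full hexagon of a simply connected `Λ` whose boundary image
polygon is convex ⇒ no triangle of the developing map is reversed, i.e. the strict no-fold
inequality at every vertex and every labelling (qualitative `(K)`). The convexity hypothesis is
abstracted as a predicate `Convex` on `Λ` to be instantiated by the prover (e.g. "lattice-convex":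
intersection of `Λ`'s hexagon set with every lattice line is an interval). -/
theorem C1_noFold_of_hull (Convex : Finset HexVertex → Prop) :
    ∀ (Λ : Finset HexVertex), hexDomainSimplyConnected Λ → Convex Λ →
      ∀ a ∈ hexDomainBoundary Λ, HexHullCondition Λ a → ∀ v ∈ Λ,
      ∀ w₀ w₁ w₂ : HexVertex, hexGraph.Adj v w₀ → hexGraph.Adj v w₁ → hexGraph.Adj v w₂ →
      w₀ ≠ w₁ → w₁ ≠ w₂ → w₀ ≠ w₂ →
      let F : Sym2 HexVertex → ℂ := hexParafermionicObservable Λ a hexCriticalFugacity (5 / 8)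
      let ω : ℂ := Complex.exp (2 * Real.pi * Complex.I / 3)
      F s(v, w₀) + F s(v, w₁) + F s(v, w₂) ≠ 0 →
      ‖F s(v, w₀) + ω * F s(v, w₁) + ω ^ 2 * F s(v, w₂)‖ <
        ‖F s(v, w₀) + F s(v, w₁) + F s(v, w₂)‖ := by
  sorry

/-- Sanity: the crux decl is in scope by name. -/
example : Prop := Summit.CriticalPhenomena.SAWScalingLimit.Theses.SAWDevelopingMap.NoFoldBound

end Summit.CriticalPhenomena.SAWScalingLimit.Cruxes.NoFoldBound.Sketch
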